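import Summits.QuantumAdvantage.QuantumAdvantage.Theses.StabilizerDial
import Summits.QuantumAdvantage.QuantumAdvantage.Theorems.StabilizerDialGaugeZ

/-!
# StabilizerDial — the split glue `StabSplitGlue3` (item stmt-QuantumAdvantage-27139) and the assembly (27140)

Route `route-QuantumAdvantage-StabilizerDial` (decomp-qadv, lens-2 g17 «StabilizerDial», writer g7; D-0170 child of
HolonomyDial:AvoidLift3, born 2026-08-31T00:04Z) cuts the junction `ExactnessDial.PolyLossOddU3` (26531) into
`FewLocusLoss3` (U, crux) and `StabGenericLossPos3` (G, residual).  The glue binder of the route's `closes` —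
`FewLocusLoss3 → StabGenericLossPos3 → ExactnessDial.PolyLossOddU3` — is the proved dichotomy of the node, available in
the tree as `Theorems.StabilizerDial.polyLossOddU3_of_stabPos` (part `StabilizerDialGaugeZ`, landed p793751): at budget
`c`, split on `StabFew (c+1) c (c+1) P`; structured ⇒ U at `(c+1, c, c+2)` applied to the pad (win set unchanged,
`winset_pad`); generic ⇒ G at `(c, c, c)`; `C := max`.  The route's item decls are the landed Theorems-side texts verbatim
(`Iff.rfl`; critic PB88 `critic_stabSplitGlue3` compiles with exactly this term).  Census instrument seat
decomp-qadv-census-1 g8, on the writer's ROUTE-BORN note «27139 … @census-1 closable» and critic PB88 (ENDORSED).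
-/

set_option linter.dupNamespace false

namespace Summit.QuantumAdvantage.QuantumAdvantage.Theorems

/-- **Glue of the StabilizerDial split** (item 27139, support): `FewLocusLoss3 → StabGenericLossPos3 →
ExactnessDial.PolyLossOddU3`, by the landed dichotomy `Theorems.StabilizerDial.polyLossOddU3_of_stabPos` (the route's
pieces unfold to the Theorems-side ones). -/
theorem stabilizerDial_stabSplitGlue3 : Summit.QuantumAdvantage.QuantumAdvantage.Theses.StabilizerDial.StabSplitGlue3 := by
  intro hU hG
  exact Summit.QuantumAdvantage.QuantumAdvantage.Theorems.StabilizerDial.polyLossOddU3_of_stabPos hU hG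

/-- **Assembly of route StabilizerDial** (item 27140): the pieces in rank order yield the junction
`ExactnessDial.PolyLossOddU3` — pure logic, the glue applied to U and G. -/
theorem stabilizerDial_assembly : Summit.QuantumAdvantage.QuantumAdvantage.Theses.StabilizerDial.Assembly :=
  fun hU hG g => g hU hG

end Summit.QuantumAdvantage.QuantumAdvantage.Theorems
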